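import Summits.MatrixMultiplication.OmegaCensus.STPPVosperSlackOneLawA2Cover

/-!
# ω-census (abelian STPP census): the `a = 2` slack-1 law with the exact-cover stage, case-α₂ table given by its SPECIFICATION (kernel, UNCONDITIONAL)

HONEST FRAMING (pub-omega census; verbatim): lottery ticket; floor = certified bounds/negative ranges.
Census STRUCTURE (seat pub-omega-stpp-1 gen 31, 2026-08-28), family (b2).  `no_isSTPP_of_slack_one_tables_prime_a2_cover`
(`STPPVosperSlackOneLawA2Cover.lean`) takes the case-α₂ cover table as the `Bool` computation `tableAlpha2Cover … = true`, which is too slow for the kernel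
when the window is large (`(2,4,4)² ⊆ ℤ₆₁`: window `50` of `61`).  THIS FILE restates the law with the case-α₂ hypothesis in SPECIFICATION FORM
(`hspecα`): for every window configuration `(j, ℓ₁, t₁, t₂)` whose point list is duplicate-free and satisfies the prefix law, `j ∈ J` or the cover search
fails.  Any checker proving this ∀-statement may then be used (e.g. the row checker of `STPPVosperSlackOneA2CoverRows.lean`, which exploits
duplicate-freeness for cheap pre-tests).  The extra premise — duplicate-freeness of the list of the `ℓ₁ + ℓ₂ + 2` window points — holds for the actual
configuration because `−Aᵢ + Y°` has `m + 1 = L + 2` elements.  Cases β, γ unchanged; Hamidoune–Rødseth is the theorem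
`hamidouneRodsethInverseTheorem_holds`.  Nothing here is progress on `ω`.

References: Y. O. Hamidoune, Ø. J. Rødseth, Acta Arith. 92 (2000) 251–262; A. G. Vosper, J. London Math. Soc. 31 (1956); M. B. Nathanson, GTM 165,
Thm 2.7; H. Cohn, R. Kleinberg, B. Szegedy, C. Umans, FOCS 2005 (arXiv:math/0511460), Def. 5.1.
-/

open Finset
open scoped Pointwise

namespace Summit.MatrixMultiplication.OmegaCensus.CubeNB

open Literature.Computability.AlgebraicComplexity
open Literature.Combinatorics.Additive
open Summit.MatrixMultiplication.OmegaCensus.STPPKneser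

variable {p : ℕ} [hp : Fact p.Prime]

/-- The list of window points of a case-α₂ configuration: `[t₁ + j i : i ≤ ℓ₁] ++ [t₂ + j i : i ≤ L − ℓ₁]` (residues mod `p`). [folklore] -/
def windowList (p j ℓ₁ L t₁ t₂ : ℕ) : List ℕ :=
  ((List.range (ℓ₁ + 1)).map fun i => (t₁ + j * i) % p) ++ ((List.range (L - ℓ₁ + 1)).map fun i => (t₂ + j * i) % p)

/-- **The slack-1 Vosper law at prime order for a block with `a = 2`, exact-cover stage in case α₂, case-α₂ table in specification form (kernel,
UNCONDITIONAL).**  As `no_isSTPP_of_slack_one_tables_prime_a2_cover`, with `tableAlpha2Cover … = true` replaced by its consequence `hspecα`: for all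
`j < p`, `1 ≤ ℓ₁`, `2ℓ₁ ≤ L`, `t₁, t₂ < p` with both window progressions inside `[0, n+1)`, the window point list duplicate-free and the prefix law true,
`j ∈ J` or `existsCover p z (coverYL p j ℓ₁ L t₁ t₂) (ks.map sizes) [] [] = false`.
[cite: CohnKleinbergSzegedyUmans2005, Def. 5.1] [cite: Vosper1956, main theorem; Nathanson1996, Thm 2.7]
[cite: HamidouneRodseth2000, main theorem (§1, p. 252); SerraZemor2000, Theorem 3] -/
theorem no_isSTPP_of_slack_one_tables_prime_a2_coverSpec {N : ℕ} (A B C : Fin N → Finset (ZMod p))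
    (hS : IsSTPP A B C) (hA : ∀ k, (A k).Nonempty) (hB : ∀ k, (B k).Nonempty) (hC : ∀ k, (C k).Nonempty)
    (i : Fin N) (hI : ((univ : Finset (Fin N)).erase i).Nonempty)
    (ks : List (Fin N)) (hks : ks.Nodup) (hksi : ∀ k, k ∈ ks ↔ k ≠ i)
    {a b vol z L m n : ℕ} (ha : #(A i) = a) (hb : #(B i) = b) (hvol : #(A i) * #(B i) * #(C i) = vol)
    (hz : ∑ k ∈ univ.erase i, #(A k) * #(C k) = z) (hL : ∑ k ∈ univ.erase i, #(B k) * #(C k) = L)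
    (h2a : a = 2) (h3b : 3 ≤ b) (h4z : 4 ≤ z) (h4L : 4 ≤ L) (hslack : z + b + vol + a + L = p + 1)
    (hm : L + a = m + 1) (hn : vol + m = n) {J : Finset ℕ}
    (hJ : ∀ jv ∈ J, jv = 0 ∨ (∃ k ∈ range b, 1 ≤ k ∧ (jv = k ∨ jv + k = p)) ∨ (∃ k ∈ range a, 1 ≤ k ∧ (jv * k % p = 1 ∨ jv * k % p = p - 1)))
    (htableγ : ∀ j < p, ∀ t < p, (∀ i' < m, (t + j * i') % p < n) →
      (∀ k < m, b ∣ (t + j * k) % p - #((range m).filter fun i' => (t + j * i') % p < (t + j * k) % p)) → j ∈ J)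
    (hspecα : ∀ j < p, ∀ ℓ₁, 1 ≤ ℓ₁ → 2 * ℓ₁ ≤ L → ∀ t₁ < p, ∀ t₂ < p, (∀ i < ℓ₁ + 1, (t₁ + j * i) % p < n + 1) →
      (∀ i < L - ℓ₁ + 1, (t₂ + j * i) % p < n + 1) → (windowList p j ℓ₁ L t₁ t₂).Nodup →
      prefixOK b ((range (ℓ₁ + 1)).image (fun i => (t₁ + j * i) % p) ∪ (range (L - ℓ₁ + 1)).image (fun i => (t₂ + j * i) % p)) = true →
      j ∈ J ∨ existsCover p z (coverYL p j ℓ₁ L t₁ t₂) (ks.map fun k => (#(A k), #(B k), #(C k))) [] [] = false)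
    (htableβ : tableBeta p (n + 1) m b J = true) : False := by
  have hHR : HamidouneRodsethInverseTheorem := hamidouneRodsethInverseTheorem_holds
  have hp2 : 2 ≤ p := hp.out.two_le
  have hcardp : Fintype.card (ZMod p) = p := ZMod.card p
  -- the objects
  set W := ((A i) ×ˢ ((B i) ×ˢ (C i))).image fun q : ZMod p × ZMod p × ZMod p => (0 : ZMod p) + q.2.2 - q.1 - q.2.1 with hW
  set Sn := (A i).image (fun x => (0 : ZMod p) - x) with hSn
  set Yo := DU B C (univ.erase i) with hYo
  set Zo := DU A C (univ.erase i) with hZo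
  have hWcard : #W = vol := by rw [hW, card_image_blockSum hS i 0, hvol]
  have hSncard : #Sn = a := by rw [hSn, Finset.card_image_of_injective _ sub_right_injective, ha]
  have hYocard : #Yo = L := by rw [hYo, card_DU_BC hS hA, hL]
  have hZocard : #Zo = z := by rw [hZo, card_DU_AC hS hB, hz]
  have hSnne : Sn.Nonempty := (hA i).image _
  have hYone : Yo.Nonempty := DU_nonempty hI hB hC
  have hWV : Disjoint W (Sn + Yo) := disjoint_W_negA_add_DU hS i
  have hVcard : #(W ∪ (Sn + Yo)) = vol + #(Sn + Yo) := by rw [Finset.card_union_of_disjoint hWV, hWcard]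
  have hsub : B i + (W ∪ (Sn + Yo)) ⊆ univ \ Zo := B_add_W_union_negA_add_subset hS i
  have hvol1 : 1 ≤ vol := by rw [← hvol]; exact Nat.mul_pos (Nat.mul_pos (hA i).card_pos (hB i).card_pos) (hC i).card_pos
  have hU : #(univ \ Zo) = p - z := by
    rw [Finset.card_sdiff_of_subset (Finset.subset_univ _), Finset.card_univ, hcardp, hZocard]
  have hzle : z ≤ p := by have h := Finset.card_le_univ Zo; rwa [hcardp, hZocard] at h
  have hBV_le : #(B i + (W ∪ (Sn + Yo))) ≤ p - z := hU ▸ Finset.card_le_card hsub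
  -- Cauchy–Davenport twice
  have hWne : W.Nonempty := Finset.card_pos.1 (by rw [hWcard]; exact hvol1)
  have hSY_ne_univ : Sn + Yo ≠ univ := by
    intro h
    obtain ⟨x, hx⟩ := hWne
    exact Finset.disjoint_left.1 hWV hx (h ▸ Finset.mem_univ x)
  have hcd1 : #Sn + #Yo ≤ #(Sn + Yo) + 1 := Vosper.cauchy_davenport_of_ne_univ hSnne hYone hSY_ne_univ
  have hZne : Zo.Nonempty := Finset.card_pos.1 (by rw [hZocard]; omega)
  have hVne : (W ∪ (Sn + Yo)).Nonempty := hWne.mono Finset.subset_union_left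
  have hBV_ne_univ : B i + (W ∪ (Sn + Yo)) ≠ univ := by
    intro h
    obtain ⟨x, hx⟩ := hZne
    have := hsub (h ▸ Finset.mem_univ x)
    rw [Finset.mem_sdiff] at this
    exact this.2 hx
  have hcd2 : #(B i) + #(W ∪ (Sn + Yo)) ≤ #(B i + (W ∪ (Sn + Yo))) + 1 :=
    Vosper.cauchy_davenport_of_ne_univ (hB i) hVne hBV_ne_univ
  rw [hSncard, hYocard] at hcd1
  rw [hb, hVcard] at hcd2
  -- numerology: #(Sn + Yo) ∈ {m, m+1}
  have hSYge : m ≤ #(Sn + Yo) := by omega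
  have hSYle : #(Sn + Yo) ≤ m + 1 := by omega
  have hmp : m + 2 ≤ p - 4 := by omega
  rcases Nat.eq_or_lt_of_le hSYle with hαcase | hlt
  · /- Case α: the first Cauchy–Davenport step is loose. -/
    have hVn : #(W ∪ (Sn + Yo)) = n + 1 := by rw [hVcard, hαcase]; omega
    have hBVeq : #(B i + (W ∪ (Sn + Yo))) = p - z := by omega
    have hEq : B i + (W ∪ (Sn + Yo)) = univ \ Zo := Finset.eq_of_subset_of_card_le hsub (by rw [hU, hBVeq])
    -- Vosper for (Bᵢ, V)
    have h2B : 2 ≤ #(B i) := by rw [hb]; omega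
    have h2V : 2 ≤ #(W ∪ (Sn + Yo)) := by rw [hVn]; omega
    have hcrit2 : #(B i + (W ∪ (Sn + Yo))) = #(B i) + #(W ∪ (Sn + Yo)) - 1 := by rw [hb, hVn]; omega
    have hsmall2 : #(B i + (W ∪ (Sn + Yo))) ≤ p - 2 := by omega
    obtain ⟨e', he', hBap, hVap⟩ := vosper_inverse h2B h2V hcrit2 hsmall2
    obtain ⟨β, hβ⟩ := hBap
    obtain ⟨v, hv⟩ := hVap
    rw [hb] at hβ; rw [hVn] at hv
    -- the two-run structure of Y° (a = 2: Sn = {σ, σ + s})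
    obtain ⟨α₁, α₂, hα12, hAeq⟩ := Finset.card_eq_two.1 (by rw [ha, h2a] : #(A i) = 2)
    have hSnE : Sn = {(0 : ZMod p) - α₁, ((0 : ZMod p) - α₁) + (α₁ - α₂)} := by
      rw [hSn, hAeq, Finset.image_insert, Finset.image_singleton]
      congr 1
      · rw [show (0 : ZMod p) - α₁ + (α₁ - α₂) = 0 - α₂ by abel]
    set σ : ZMod p := 0 - α₁ with hσ
    set s : ZMod p := α₁ - α₂ with hs
    have hs0 : s ≠ 0 := fun h => hα12 (by rw [hs] at h; linear_combination h)
    have hSYeq : Sn + Yo = σ +ᵥ (Yo ∪ (s +ᵥ Yo)) := by rw [hSnE]; exact pair_add_eq_vadd_union σ s Yo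
    have hUcard : #(Yo ∪ (s +ᵥ Yo)) = #Yo + 2 := by
      have h := congrArg Finset.card hSYeq
      rw [Finset.card_vadd_finset] at h
      rw [← h, hαcase, hYocard]; omega
    obtain ⟨c₁, c₂, ℓ₁, ℓ₂, hℓ1, hℓ12, hℓsum, hYoE⟩ := two_runs_of_card_union_vadd hs0 hUcard
    rw [hYocard] at hℓsum
    -- Sn + Yo = two progressions of ℓ₁ + 1 and ℓ₂ + 1 terms
    have hSYsub : Sn + Yo ⊆ apFinset (σ + c₁) s (ℓ₁ + 1) ∪ apFinset (σ + c₂) s (ℓ₂ + 1) := by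
      rw [hSnE, pair_eq_apFinset, hYoE, Finset.add_union]
      apply Finset.union_subset_union
      · have h := apFinset_add_apFinset_subset σ c₁ s 2 ℓ₁
        rwa [show 2 + ℓ₁ - 1 = ℓ₁ + 1 by omega] at h
      · have h := apFinset_add_apFinset_subset σ c₂ s 2 ℓ₂
        rwa [show 2 + ℓ₂ - 1 = ℓ₂ + 1 by omega] at h
    have hSYE : Sn + Yo = apFinset (σ + c₁) s (ℓ₁ + 1) ∪ apFinset (σ + c₂) s (ℓ₂ + 1) := by
      apply Finset.eq_of_subset_of_card_le hSYsub
      have h1 := (Finset.card_union_le _ _).trans (Nat.add_le_add (card_apFinset_le (σ + c₁) s (ℓ₁ + 1)) (card_apFinset_le (σ + c₂) s (ℓ₂ + 1)))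
      rw [hαcase]; omega
    -- pairs: Aᵢ = {α₁, α₂} at distance s; Bᵢ a b-term progression
    have hApairs : ∀ k, 1 ≤ k → k < a → ∃ α, α ∈ A i ∧ α + k • s ∈ A i := by
      intro k hk1 hk
      have hk' : k = 1 := by omega
      subst hk'
      refine ⟨α₂, by rw [hAeq]; simp, ?_⟩
      rw [one_nsmul, hs, show α₂ + (α₁ - α₂) = α₁ by abel, hAeq]; simp
    have hBpairs := pairs_of_apFinset hβ
    obtain ⟨b', rfl⟩ : ∃ b', b = b' + 1 := ⟨b - 1, by omega⟩
    -- transport and table α₂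
    obtain ⟨hSsub', hgap⟩ := prefix_law_of_runs hS i (SY := Sn + Yo) (N₁ := n + 1) he' hβ hWV hv (by omega)
    have hn1 : n + 1 ≤ p := by omega
    set u : ZMod p := e'⁻¹ with hu
    set w : ZMod p := -(e'⁻¹ * v) with hw
    have hSimg : (Sn + Yo).image (fun x => e'⁻¹ * x + -(e'⁻¹ * v)) =
        apFinset (u * (σ + c₁) + w) (u * s) (ℓ₁ + 1) ∪ apFinset (u * (σ + c₂) + w) (u * s) (ℓ₂ + 1) := by
      rw [hSYE, Finset.image_union, image_affine_apFinset, image_affine_apFinset]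
    rw [hSimg] at hSsub' hgap
    have hj0 : u * s ≠ 0 := mul_ne_zero (inv_ne_zero he') hs0
    have hPS : (apFinset (u * (σ + c₁) + w) (u * s) (ℓ₁ + 1) ∪ apFinset (u * (σ + c₂) + w) (u * s) (ℓ₂ + 1)).image ZMod.val =
        (range (ℓ₁ + 1)).image (fun i => ((u * (σ + c₁) + w).val + (u * s).val * i) % p) ∪
          (range (L - ℓ₁ + 1)).image (fun i => ((u * (σ + c₂) + w).val + (u * s).val * i) % p) := by
      rw [Finset.image_union, image_val_apFinset, image_val_apFinset, show ℓ₂ = L - ℓ₁ by omega]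
    have hpre := prefixOK_of_val hPS hgap
    have hw1 : ∀ i < ℓ₁ + 1, ((u * (σ + c₁) + w).val + (u * s).val * i) % p < n + 1 := by
      intro i hi
      rw [← val_add_nsmul_zmod]
      exact (mem_apFinset_zero_one_iff hn1).1 (hSsub' (Finset.mem_union_left _ (mem_apFinset.2 ⟨i, hi, rfl⟩)))
    have hw2 : ∀ i < L - ℓ₁ + 1, ((u * (σ + c₂) + w).val + (u * s).val * i) % p < n + 1 := by
      intro i hi
      rw [← val_add_nsmul_zmod]
      exact (mem_apFinset_zero_one_iff hn1).1 (hSsub' (Finset.mem_union_right _ (mem_apFinset.2 ⟨i, by omega, rfl⟩)))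
    -- the window point list is duplicate-free: `Sn + Yo` has `m + 1 = ℓ₁ + ℓ₂ + 2` elements
    have hWnd : (windowList p (u * s).val ℓ₁ L (u * (σ + c₁) + w).val (u * (σ + c₂) + w).val).Nodup := by
      have hRdisj : Disjoint (apFinset (u * (σ + c₁) + w) (u * s) (ℓ₁ + 1)) (apFinset (u * (σ + c₂) + w) (u * s) (ℓ₂ + 1)) := by
        rw [Finset.disjoint_iff_inter_eq_empty, ← Finset.card_eq_zero]
        have h := Finset.card_union_add_card_inter (apFinset (u * (σ + c₁) + w) (u * s) (ℓ₁ + 1)) (apFinset (u * (σ + c₂) + w) (u * s) (ℓ₂ + 1))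
        have hc : #(apFinset (u * (σ + c₁) + w) (u * s) (ℓ₁ + 1) ∪ apFinset (u * (σ + c₂) + w) (u * s) (ℓ₂ + 1)) = m + 1 := by
          rw [← hSimg, Finset.card_image_of_injective _ (fun x y hxy => by simpa [hj0, inv_ne_zero he'] using hxy), hαcase]
        rw [hc, card_apFinset hj0 (by omega), card_apFinset hj0 (by omega)] at h
        omega
      have hvinj : ∀ {T : ZMod p} {i i' : ℕ}, i < p → i' < p → (T.val + (u * s).val * i) % p = (T.val + (u * s).val * i') % p → i = i' := by
        intro T i i' hi hi' h
        rw [← val_add_nsmul_zmod, ← val_add_nsmul_zmod] at h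
        exact HamidouneRodseth.nat_eq_of_nsmul_eq hj0 hi hi' (add_left_cancel (ZMod.val_injective p h))
      rw [windowList, List.nodup_append]
      refine ⟨?_, ?_, ?_⟩
      · exact List.Nodup.map_on (fun i hi i' hi' h => hvinj (by rw [List.mem_range] at hi; omega) (by rw [List.mem_range] at hi'; omega) h)
          List.nodup_range
      · exact List.Nodup.map_on (fun i hi i' hi' h => hvinj (by rw [List.mem_range] at hi; omega) (by rw [List.mem_range] at hi'; omega) h)
          List.nodup_range
      · intro y hy y' hy' hyy
        obtain ⟨i, hi, rfl⟩ := List.mem_map.1 hy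
        obtain ⟨i', hi', rfl⟩ := List.mem_map.1 hy'
        rw [List.mem_range] at hi hi'
        rw [← val_add_nsmul_zmod, ← val_add_nsmul_zmod] at hyy
        have h2 := ZMod.val_injective p hyy
        exact Finset.disjoint_left.1 hRdisj (mem_apFinset.2 ⟨i, hi, rfl⟩) (h2 ▸ mem_apFinset.2 ⟨i', by omega, rfl⟩)
    rcases hspecα (u * s).val (ZMod.val_lt _) ℓ₁ hℓ1 (by omega) _ (ZMod.val_lt _) _ (ZMod.val_lt _) hw1 hw2 hWnd hpre
      with hval | hcover
    · exact false_of_ratio_val_mem_mult hS i hs0 he' (by omega) (by omega) hJ hval hApairs hBpairs (hC i)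
    · /- The exact-cover stage: `Z°` is an `e′`-progression, `Y°` two `s`-runs; the other blocks cover both exactly. -/
      -- `Z° = H ∖ (Bᵢ + V)` is an `e′`-progression
      have hAPBV : IsAP (B i + (W ∪ (Sn + Yo))) e' :=
        IsAP.add ⟨β, by rw [hb]; exact hβ⟩ ⟨v, by rw [hVn]; exact hv⟩ (by rw [hBVeq, hb, hVn]; omega)
      have hAPZo : IsAP Zo e' := by
        have h := hAPBV.compl he'
        rwa [hEq, ← Finset.compl_eq_univ_sdiff, compl_compl] at h
      obtain ⟨z₀, hzo⟩ := hAPZo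
      rw [hZocard] at hzo
      -- the two runs of `Y°` are disjoint
      have hYdisj : Disjoint (apFinset c₁ s ℓ₁) (apFinset c₂ s ℓ₂) := by
        rw [Finset.disjoint_iff_inter_eq_empty, ← Finset.card_eq_zero]
        have h := Finset.card_union_add_card_inter (apFinset c₁ s ℓ₁) (apFinset c₂ s ℓ₂)
        rw [← hYoE, hYocard, card_apFinset hs0 (by omega), card_apFinset hs0 (by omega)] at h
        omega
      -- window coordinates: `x ↦ u (x − y₀)` with `y₀ = v − σ` is `x ↦ u (σ + x) + w`
      set T₁ : ZMod p := u * (σ + c₁) + w with hT₁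
      set T₂ : ZMod p := u * (σ + c₂) + w with hT₂
      have hcoord : ∀ (c : ZMod p) (i : ℕ), e'⁻¹ * (c + i • s - (v - σ)) = (u * (σ + c) + w) + i • (u * s) := by
        intro c i
        rw [hw, hu, nsmul_eq_mul, nsmul_eq_mul]; ring
      have hval1 : ∀ i : ℕ, (e'⁻¹ * (c₁ + i • s - (v - σ))).val = (T₁.val + (u * s).val * i) % p := by
        intro i; rw [hcoord, ← hT₁, val_add_nsmul_zmod]
      have hval2 : ∀ i : ℕ, (e'⁻¹ * (c₂ + i • s - (v - σ))).val = (T₂.val + (u * s).val * i) % p := by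
        intro i; rw [hcoord, ← hT₂, val_add_nsmul_zmod]
      have hYL : coverYL p (u * s).val ℓ₁ L T₁.val T₂.val =
          ((List.range ℓ₁).map fun i => (T₁.val + (u * s).val * i) % p) ++
            ((List.range ℓ₂).map fun i => (T₂.val + (u * s).val * i) % p) := by
        rw [coverYL, show L - ℓ₁ = ℓ₂ by omega]
      -- membership and surjectivity of the value list
      have hYin : ∀ x ∈ Yo, (e'⁻¹ * (x - (v - σ))).val ∈ coverYL p (u * s).val ℓ₁ L T₁.val T₂.val := by
        intro x hx
        rw [hYL, List.mem_append]
        rw [hYoE, Finset.mem_union] at hx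
        rcases hx with hx | hx
        · obtain ⟨i, hi, rfl⟩ := mem_apFinset.1 hx
          exact Or.inl (List.mem_map.2 ⟨i, List.mem_range.2 hi, (hval1 i).symm⟩)
        · obtain ⟨i, hi, rfl⟩ := mem_apFinset.1 hx
          exact Or.inr (List.mem_map.2 ⟨i, List.mem_range.2 hi, (hval2 i).symm⟩)
      have hYsurj : ∀ y ∈ coverYL p (u * s).val ℓ₁ L T₁.val T₂.val, ∃ x ∈ Yo, (e'⁻¹ * (x - (v - σ))).val = y := by
        intro y hy
        rw [hYL, List.mem_append] at hy
        rcases hy with hy | hy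
        · obtain ⟨i, hi, rfl⟩ := List.mem_map.1 hy
          rw [List.mem_range] at hi
          exact ⟨c₁ + i • s, by rw [hYoE]; exact Finset.mem_union_left _ (mem_apFinset.2 ⟨i, hi, rfl⟩), hval1 i⟩
        · obtain ⟨i, hi, rfl⟩ := List.mem_map.1 hy
          rw [List.mem_range] at hi
          exact ⟨c₂ + i • s, by rw [hYoE]; exact Finset.mem_union_right _ (mem_apFinset.2 ⟨i, hi, rfl⟩), hval2 i⟩
      -- the value list is duplicate-free
      have hinj : ∀ x x' : ZMod p, (e'⁻¹ * (x - (v - σ))).val = (e'⁻¹ * (x' - (v - σ))).val → x = x' := by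
        intro x x' h
        have h1 := mul_left_cancel₀ (inv_ne_zero he') (ZMod.val_injective p h)
        simpa using h1
      have hYLnd : (coverYL p (u * s).val ℓ₁ L T₁.val T₂.val).Nodup := by
        rw [hYL, List.nodup_append]
        refine ⟨?_, ?_, ?_⟩
        · refine List.Nodup.map_on (fun i hi i' hi' h => ?_) List.nodup_range
          rw [List.mem_range] at hi hi'
          rw [← hval1, ← hval1] at h
          have h2 := hinj _ _ h
          exact HamidouneRodseth.nat_eq_of_nsmul_eq hs0 (by omega) (by omega) (add_left_cancel h2)
        · refine List.Nodup.map_on (fun i hi i' hi' h => ?_) List.nodup_range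
          rw [List.mem_range] at hi hi'
          rw [← hval2, ← hval2] at h
          have h2 := hinj _ _ h
          exact HamidouneRodseth.nat_eq_of_nsmul_eq hs0 (by omega) (by omega) (add_left_cancel h2)
        · intro y hy y' hy' hyy
          obtain ⟨i, hi, rfl⟩ := List.mem_map.1 hy
          obtain ⟨i', hi', rfl⟩ := List.mem_map.1 hy'
          rw [List.mem_range] at hi hi'
          rw [← hval1, ← hval2] at hyy
          have h2 := hinj _ _ hyy
          exact Finset.disjoint_left.1 hYdisj (mem_apFinset.2 ⟨i, hi, rfl⟩) (h2 ▸ mem_apFinset.2 ⟨i', hi', rfl⟩)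
      have htrue := existsCover_true_of_isSTPP hS hA hB hC i ks hks hksi he' hzo hZocard hYLnd hYin hYsurj
      rw [htrue] at hcover
      exact Bool.noConfusion hcover
  · /- Cases β, γ: the first step is tight, Vosper for (Sn, Yo). -/
    have hSYm : #(Sn + Yo) = m := by omega
    have hVn : #(W ∪ (Sn + Yo)) = n := by rw [hVcard, hSYm, hn]
    have h2S : 2 ≤ #Sn := by rw [hSncard]; omega
    have h2Yo : 2 ≤ #Yo := by rw [hYocard]; omega
    have hcrit1 : #(Sn + Yo) = #Sn + #Yo - 1 := by rw [hSncard, hYocard]; omega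
    have hsmall1 : #(Sn + Yo) ≤ p - 2 := by omega
    obtain ⟨d, hd, hSap, hYap⟩ := vosper_inverse h2S h2Yo hcrit1 hsmall1
    obtain ⟨s₀, hs₀⟩ := hSap
    obtain ⟨y₀, hy⟩ := hYap
    rw [hSncard] at hs₀; rw [hYocard] at hy
    have hsubm : Sn + Yo ⊆ apFinset (s₀ + y₀) d m := by
      have h := apFinset_add_apFinset_subset s₀ y₀ d a L
      rw [show a + L - 1 = m by omega] at h
      rwa [hs₀, hy]
    have hSY : Sn + Yo = apFinset (s₀ + y₀) d m :=
      Finset.eq_of_subset_of_card_le hsubm (by rw [hSYm, card_apFinset hd (by omega)])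
    -- pairs in Aᵢ (step d): Sn is an a-term progression
    have hApairs : ∀ k, 1 ≤ k → k < a → ∃ α, α ∈ A i ∧ α + k • d ∈ A i :=
      pairs_of_neg_image (A := A) i (pairs_of_apFinset hs₀)
    rcases Nat.eq_or_lt_of_le hBV_le with hβcase | hγlt
    · /- Case β: the second Cauchy–Davenport step is loose; Hamidoune–Rødseth for (Bᵢ, V). -/
      have hEq : B i + (W ∪ (Sn + Yo)) = univ \ Zo := Finset.eq_of_subset_of_card_le hsub (by rw [hU, hβcase])
      have hHR2 := hHR p (B i) (W ∪ (Sn + Yo)) (by rw [hb]; omega) (by rw [hVn]; omega) (by omega) (by omega)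
        (by rw [hb, hVn]; omega)
      obtain ⟨e', β, v, hBsub, hVsub⟩ := hHR2
      rw [hb] at hBsub; rw [hVn] at hVsub
      have he' : e' ≠ 0 := step_ne_zero_of_subset_apFinset hBsub (by rw [hb]; omega)
      obtain ⟨g, hg, hBE⟩ := eq_apErase_of_subset_apFinset he' (by omega : b + 1 ≤ p) hBsub (by rw [hb])
      -- normalise the removed index away from the last slot
      obtain ⟨β₁, g₁, hg₁, hBE₁⟩ : ∃ β₁ : ZMod p, ∃ g₁ : ℕ, g₁ < b ∧ B i = apErase β₁ e' (b + 1) g₁ := by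
        rcases Nat.lt_or_ge g b with hgb | hgb
        · exact ⟨β, g, hgb, hBE⟩
        · have hgb' : g = b := by omega
          obtain ⟨b', rfl⟩ : ∃ b', b = b' + 1 := ⟨b - 1, by omega⟩
          refine ⟨β - e', 0, by omega, ?_⟩
          rw [hBE, hgb', apErase_last_eq_apErase_zero]
      have hBpairs : ∀ k, 1 ≤ k → k < b → ∃ β, β ∈ B i ∧ β + k • e' ∈ B i :=
        fun k hk1 hk => pairs_of_apErase hBE₁ (by omega) k hk1 (by omega)
      -- table β
      have hPcard : #((A i) ×ˢ (C i)) ≤ n + 1 := by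
        rw [Finset.card_product]
        have h1 : #(A i) * #(C i) ≤ #(A i) * #(B i) * #(C i) := by
          rw [mul_assoc, mul_comm (#(B i)) _, ← mul_assoc]
          exact Nat.le_mul_of_pos_right _ (hB i).card_pos
        rw [hvol] at h1
        omega
      have hval := holed_ratio_val_mem hS i (J := J) he' hd hg₁ hBE₁ hSY hWV hVsub hVn (by omega) hPcard
        (tableBeta_spec htableβ)
      exact false_of_ratio_val_mem_mult hS i hd he' (by omega) (by omega) hJ hval hApairs hBpairs (hC i)
    · /- Case γ: the inclusion is loose; Vosper for (Bᵢ, V). -/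
      have hBVeq : #(B i + (W ∪ (Sn + Yo))) = b + n - 1 := by omega
      have h2B : 2 ≤ #(B i) := by rw [hb]; omega
      have h2V : 2 ≤ #(W ∪ (Sn + Yo)) := by rw [hVn]; omega
      have hcrit2 : #(B i + (W ∪ (Sn + Yo))) = #(B i) + #(W ∪ (Sn + Yo)) - 1 := by rw [hb, hVn]; omega
      have hsmall2 : #(B i + (W ∪ (Sn + Yo))) ≤ p - 2 := by omega
      obtain ⟨e', he', hBap, hVap⟩ := vosper_inverse h2B h2V hcrit2 hsmall2
      obtain ⟨β, hβ⟩ := hBap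
      obtain ⟨v, hv⟩ := hVap
      rw [hb] at hβ; rw [hVn] at hv
      have hBpairs := pairs_of_apFinset hβ
      obtain ⟨b', rfl⟩ : ∃ b', b = b' + 1 := ⟨b - 1, by omega⟩
      obtain ⟨hSsub', hgap⟩ := prefix_law_of_runs hS i (SY := Sn + Yo) (N₁ := n) he' hβ hWV hv (by omega)
      rw [hSY, image_affine_apFinset] at hSsub' hgap
      have hval := val_mem_of_nat_table_prime (p := p) (n := n) (m := m) (r := b' + 1) (J := J)
        (by omega) (by omega) htableγ (mul_ne_zero (inv_ne_zero he') hd) hSsub' hgap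
      exact false_of_ratio_val_mem_mult hS i hd he' (by omega) (by omega) hJ hval hApairs hBpairs (hC i)

end Summit.MatrixMultiplication.OmegaCensus.CubeNB
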